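import Summits.AtomisticToContinuum.BoseEinsteinCondensation.Theorems.BECCutLineWeakDisorderLateCoreSplitLateWitnessTransfer
import Summits.AtomisticToContinuum.BoseEinsteinCondensation.Theorems.BECCutLineWeakDisorderLateCoreSplitOfCrux
import Summits.AtomisticToContinuum.BoseEinsteinCondensation.Theorems.BECCutLineWeakDisorderLateCoreSplitCloses
import Summits.AtomisticToContinuum.BoseEinsteinCondensation.Theorems.BECCutLineWeakDisorderLateCoreSplitZeroModeGroundState
import Summits.AtomisticToContinuum.BoseEinsteinCondensation.Theorems.BECCutLineWeakDisorderLateCoreSplitGroundStateCalibration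
import Summits.AtomisticToContinuum.BoseEinsteinCondensation.Theorems.BECCutLineWeakDisorderLateCoreSplitZeroModeNecessity
import Summits.AtomisticToContinuum.BoseEinsteinCondensation.Theorems.BECCutLineWeakDisorderLateCoreSplitZeroModeNecessityBounded
import Summits.AtomisticToContinuum.BoseEinsteinCondensation.Theorems.BECCutLineWeakDisorderLateCoreSplitSummitNecessity
import Summits.AtomisticToContinuum.BoseEinsteinCondensation.Theorems.BECCutLineWeakDisorderLateCoreSplitNearGroundState
import Summits.AtomisticToContinuum.BoseEinsteinCondensation.Theorems.BECCutLineWeakDisorderLateCoreSplitZeroModeSummitNecessity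
import HarnessLib
import HarnessLib.Audit

/-!
# Crux `TwoReplicaTransienceBound` (stmt-AtomisticToContinuum-9687) — CHECKED SKELETON of the line
# `late-core-split`, v16 (lead c23, 2026-08-17T13:4xZ: byte-identical to v15 below this header line — 25th lead seat, decision inputs unchanged since c22 (item 0686 open 08:15:50Z, Disproof.lean 2026-08-16T11:34Z, route rev 9), verdict `promote-stub: stub_witnessZeroMode` re-affirmed, LeadC23Report.md); v15 (lead c22, 2026-08-17T13:3xZ: v14 + two NEW registered toolbox stubs, both LANDED and imported — `stub_nearMinimiserCloseFKGroundState` (p160806, Theorems/BECCutLineWeakDisorderLateCoreSplitNearGroundState.lean: near-minimisers `L²`-close to the FK ground state up to a phase; occupation stability vs a continuous reference) and `stub_zeroModeSummitNecessityBounded` (p161327, Theorems/BECCutLineWeakDisorderLateCoreSplitZeroModeSummitNecessity.lean: **the open core Z ALONE ⟹ `HasGroundStateBEC` BY NAME on bounded admissible potentials; `witnessZeroModeBdd_iff_becZeroModeBdd`: Z|bdd ⟺ item 0686's statement|bdd BY NAME**); v14 = c18, v12 = c17, v11 = c16, v10 = c15, v9 = c14, v8 = c13, v7 = c12, v6 =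 c11, v5 = c10, v4 = c7/c9; everything provable has LANDED)

v1 = the strategist's skeleton (cstrat-stmt-AtomisticToContinuum-9687-s1, 2026-08-17T02:51Z; census
`…/STRATEGY-CENSUS.md`): `crux ⟺ Z ∧ A ∧ O` along the two uniformities of the crux.
LANDED by lead c7 (all `--supports stmt-AtomisticToContinuum-9687`, kernel-checked, 0 sorries, 0 warnings):
* `Theorems/BECCutLineWeakDisorderLateCoreSplitDefs.lean` (p139781): `overlap`, `sliceMassSq`, Z =
  `WitnessZeroMode`, A = `OverlapNoIntermittency`, O = `NoTransientOvershoot`, `LateTwoReplicaBound`, Goal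
  aliases; sorry-free `late_of_zeroMode_noIntermittency` (Z → A → Late), `twoReplicaTransienceBound_of_late`,
  `TwoReplicaTransienceBound_of` = registered `stub_lateCoreCompose` (Z → A → O → crux BY NAME),
  `landscapeBound_of_late`, `noTransientOvershoot_of_crux`, `late_of_crux`;
* `Theorems/BECCutLineWeakDisorderLateCoreSplitGlueLate.lean` (p140121): toolbox stub `stub_glueLandscapeAtLate`
  — the landed finite-`T` landscape glue with the two-replica hypothesis weakened to `∀ T ≥ T₁`;
* `Theorems/BECCutLineWeakDisorderLateCoreSplitLateWitnessTransfer.lean` (p140392): registered stub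
  **`stub_lateWitnessTransfer : LateTwoReplicaBound → LandscapeBound` PROVED**, and
  `landscapeBound_of_zeroMode_noIntermittency : Z → A → LandscapeBound` — the route's hinge from the two
  late-time inputs alone (O and the `∀ T ≥ 1` excess leave the route's critical path);
* `Theorems/BECCutLineWeakDisorderLateCoreSplitOfCrux.lean` (p140379): toolbox stub `stub_splitOfCrux` —
  **the split is LOSSLESS: `TwoReplicaTransienceBound ↔ Z ∧ A ∧ O`** (`crux → Z` by Cauchy–Schwarz across
  slices `L³ ≤ I·S`, `crux → A` by `S ≤ L³`);
* `Theorems/BECCutLineWeakDisorderLateCoreSplitCloses.lean` (p140538): toolbox stub `stub_becOfLateCore :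
  Z → A → GroundStateRigidity → BoseEinsteinCondensation` — the route's deciding theorem AFTER the split
  (hinge from Z ∧ A, then the proved items 9090/9088/9074/9089), and `bec_of_crux_of_rigidity`;
* `Theorems/BECCutLineWeakDisorderLateCoreSplitZeroModeGroundState.lean` (p140987): toolbox stubs
  `stub_groundStateZeroModeOfWitness` (**Z ⇒ flat-mode ODLRO of the FK ground state `Ψ₀`, uniformly in
  `n`, for bounded `v`**: `∫ s_{Ψ₀}² ≥ cL³`, i.e. `⟨φ₀,γ_{Ψ₀}φ₀⟩ ≥ c(n+1)`) and
  `stub_witnessZeroModeOfGroundState` (the converse on bounded `v`); `witnessZeroModeBdd_iff_groundStateZeroMode`;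
* `Theorems/BECCutLineWeakDisorderLateCoreSplitGroundStateCalibration.lean` (p141229): toolbox stubs
  `stub_lateBdd_iff_groundState` (`Late|bdd ⟺` ground-state two-replica bound) and
  `stub_noIntermittencyBdd_iff_groundState` (`A|bdd ⟺` ground-state `A₂` condition);
  `groundStateBound_iff_zeroMode_noIntermittency` (the split is lossless at the ground state too).
  UPSHOT: on bounded potentials the polymer length `T` is scaffolding — the open content of the line is
  two properties of the Dirichlet ground state, uniform in `N`: flat-mode condensation (Z) and
  no-intermittency of its slice participation ratio (A).

LANDED by lead c9: `…LateCoreSplitZeroModeNecessity.lean` (p142481) — toolbox stub `stub_zeroModeNecessity :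
TwoReplicaTransienceBound → GroundStateRigidity → BECInfraredBound.BecZeroModeThesis` (item 0686 BY NAME; also from Z ∧ A).
LANDED by lead c10: `…LateCoreSplitZeroModeNecessityBounded.lean` (p143443) — toolbox stub
`stub_zeroModeNecessityBounded`: the crux ALONE implies 0686's zero-mode statement at every essentially bounded
admissible `v` (rigidity discharged by the proved `groundStateRigidity_of_essBounded`; per-`v` transfer
`landscapeAt_of_cruxAt`, per-`v` glue `zeroModeAt_of_landscapeAt_of_rigidAt`; also from Z ∧ A).
LANDED by lead c22: `…LateCoreSplitNearGroundState.lean` (p160806) and `…LateCoreSplitZeroModeSummitNecessity.lean`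
(p161327) — registered toolbox stubs `stub_nearMinimiserCloseFKGroundState`, `stub_zeroModeSummitNecessityBounded`: the open
core stub Z ALONE (no A, no 9072) implies `HasGroundStateBEC v ρ` by name for every bounded admissible `v` and small `ρ`, and
restricted to bounded potentials Z is EQUIVALENT by name to item stmt-AtomisticToContinuum-0686's statement
(`witnessZeroModeBdd_iff_becZeroModeBdd`; `witnessZeroModeBdd_of_becZeroModeThesis`).
LANDED by lead c18: `…LateCoreSplitSummitNecessity.lean` (p153414) — registered toolbox stub
`stub_summitNecessityBounded`: the crux ALONE implies `HasGroundStateBEC v ρ` (LSSY (1.19), the predicate the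
summit conjunct `BoseEinsteinCondensation` is made of) at every essentially bounded admissible `v` and every small
`ρ` (`hasGroundStateBEC_essBounded_of_crux`; one-potential assembly `hasGroundStateBEC_of_zeroModeAt`);
`boseEinsteinCondensation_of_crux_of_singularBEC`: crux + BEC on the NOT-essentially-bounded class ⟹ the
sub-problem statement by name — the only gap is sibling 9072's open hard-core rigidity.
v14/v13 (lead c18, 2026-08-17T10:3xZ; 20th lead seat; nothing decision-relevant changed since c17 — LeadC18Report.md), v12 (lead c17, 2026-08-17T09:1xZ; 19th lead seat; nothing changed since c16 — LeadC17Report.md), v11 (lead c16, 2026-08-17T08:4xZ — LeadC16Report.md), v10 (lead c15, 2026-08-17T08:1xZ), v9 (lead c14) and v8 (lead c13): byte-identical to v7 below this header (17th / 16th / 15th lead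
seats; nothing in the crux directory, the item, item 0686 or the route file changed; verdict unchanged
`blocked-on: stmt-AtomisticToContinuum-0686`, LeadC15Report.md / LeadC14Report.md / LeadC13Report.md).
v7 (lead c12, 2026-08-17T07Z): byte-identical to v6 below this header (14th lead seat; no new stub, no
reshape: Z = item 0686 on the witness family, A/O conjecture inputs — `blocked-on: stmt-AtomisticToContinuum-0686`,
LeadC12Report.md). v6 (lead c11, 2026-08-17): no new stub; the three newest landed modules (GroundStateCalibration p141229,
ZeroModeNecessity p142481, ZeroModeNecessityBounded p143443) are now IMPORTED and their registered stubs
listed in the sanity block, so this one file exhibits the whole kernel-certified picture: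
crux ⟺ Z ∧ A ∧ O; crux ⟹ 0686 (given 9072; unconditionally on essentially bounded `v`); crux ⟹ `HasGroundStateBEC`|ess-bdd (p153414);
Z|bdd ⟺ ground-state flat-mode ODLRO; Late|bdd, A|bdd ⟺ their ground-state forms.

OPEN registered stubs (the three `sorry`s below): `stub_witnessZeroMode` (Z — late-time zero-mode ODLRO of
the heat-flow witness uniformly in `n`: THE SUMMIT-STRENGTH CORE, LeadC7Report §4 / census §D),
`stub_overlapNoIntermittency` (A — reverse-Jensen/`A₂` condition; conjecture input),
`stub_noTransientOvershoot` (O — crux-implied; needed only for the `∀T` parent, not for the route).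

Disproof.lean (cdisprove c1, unchanged since 2026-08-16T11:34Z): nothing bites (no annealed object; every
child is crux-implied by `stub_splitOfCrux`, hence negative-knowledge-safe); `Negative/ConstantAtLeastOne`
(`C ≥ 1`) compatible.
-/

noncomputable section

open MeasureTheory Filter Set
open scoped ENNReal NNReal Topology

namespace Summit.AtomisticToContinuum.BoseEinsteinCondensation.Cruxes.TwoReplicaTransienceBound.LateCoreSplit

open Literature.MathematicalPhysics.QuantumManyBody.BoseGas
open Summit.AtomisticToContinuum.BoseEinsteinCondensation.Theses.BECCutLineWeakDisorder

/-! ### The open stubs (sorried) -/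

/-- STUB (OPEN; the summit-strength core Z). -/
theorem stub_witnessZeroMode : Goal.stub_witnessZeroMode := by
  sorry

/-- STUB (OPEN; conjecture input A: no intermittency of the overlap). -/
theorem stub_overlapNoIntermittency : Goal.stub_overlapNoIntermittency := by
  sorry

/-- STUB (OPEN; O, the `∀T`-excess, needed only to reach the parent crux verbatim; crux-implied). -/
theorem stub_noTransientOvershoot : Goal.stub_noTransientOvershoot := by
  sorry

/-! ### The skeleton -/

/-- The skeleton: the crux BY NAME from the three sorried stubs (registered composition
`stub_lateCoreCompose` = `TwoReplicaTransienceBound_of`, landed p139781). -/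
theorem twoReplicaTransienceBound_skeleton : TwoReplicaTransienceBound :=
  TwoReplicaTransienceBound_of stub_witnessZeroMode stub_overlapNoIntermittency stub_noTransientOvershoot

/-- The ROUTE-level skeleton: the hinge `LandscapeBound` from Z and A only, through the LANDED
`stub_lateWitnessTransfer` (p140392). -/
theorem landscapeBound_skeleton : LandscapeBound :=
  landscapeBound_of_zeroMode_noIntermittency stub_witnessZeroMode stub_overlapNoIntermittency

/-! ### Sanity: the landed stubs are in scope -/

example := @stub_lateWitnessTransfer
example := @stub_glueLandscapeAtLate
example := @stub_splitOfCrux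
example := @stub_lateCoreCompose
example := @stub_becOfLateCore
example := @stub_groundStateZeroModeOfWitness
example := @stub_witnessZeroModeOfGroundState
example := @stub_lateBdd_iff_groundState
example := @stub_noIntermittencyBdd_iff_groundState
example := @groundStateBound_iff_zeroMode_noIntermittency
example := @stub_zeroModeNecessity
example := @stub_zeroModeNecessityBounded
example := @becZeroMode_bounded_of_crux
example := @bec_of_crux_of_rigidity
example := @witnessZeroModeBdd_iff_groundStateZeroMode
example := @witnessZeroMode_of_crux
example := @overlapNoIntermittency_of_crux
example := @stub_summitNecessityBounded
example := @hasGroundStateBEC_essBounded_of_crux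
example := @boseEinsteinCondensation_of_crux_of_singularBEC
example := @stub_nearMinimiserCloseFKGroundState
example := @stub_zeroModeSummitNecessityBounded
example := @hasGroundStateBEC_bounded_of_witnessZeroMode
example := @witnessZeroModeBdd_iff_becZeroModeBdd
example := @witnessZeroModeBdd_of_becZeroModeThesis
example := @not_witnessZeroMode_of_not_hasGroundStateBEC
example := @boseEinsteinCondensation_of_witnessZeroMode_of_singularBEC
example := @nearMinimiser_close_fkGroundState
example := @sqrt_occupation_le_of_continuous
example := @occupation_constMode_ofReal

end Summit.AtomisticToContinuum.BoseEinsteinCondensation.Cruxes.TwoReplicaTransienceBound.LateCoreSplit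

end
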